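import Literature.Probability.Percolation.LoopRebasing
import HarnessLib

/-!
# Sub-arcs of uniformly parametrised closed polygons

Topic: Probability / Percolation (companion of `LoopRebasing.lean`; proofs only).  For the
uniformly parametrised closed polygon `closedCurve pts` through `pts = [p₀, …, p_{n-1}]`
(segment `j` during `[j/n, (j+1)/n]`, back to `p₀` at time `1`), the dictionary between
parameter intervals and unions of consecutive edges, in the forms used to turn "a stretch of
darts of a lattice loop" into "a parameter interval of a based representative" and back
(F. Camia, C. M. Newman, Comm. Math. Phys. 268 (2006), §2 and §4: lattice loops as polygonal
curves modulo reparametrisation; DKKMO, arXiv:2012.11672v2, §1.2 eq. (1)):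

* `closedCurve_apply_mem_segment` — at a time `t ∈ [j/n, (j+1)/n]` the polygon is on the edge
  `[p_j, p_{j+1}]` (indices mod `n`); `closedCurve_apply_mem_iUnion_segment` — on
  `[j₁/n, (j₂+1)/n]` it is on one of the edges `j₁, …, j₂`;
* `exists_closedCurve_apply_eq` — conversely every point of the edge `[p_j, p_{j+1}]` is visited
  during `[j/n, (j+1)/n]`;
* `closedCurve_fract_mem_segment` — the polygon read at an unwrapped time `τ ≥ 0` (i.e. at
  `fract τ`) is on the edge of unwrapped index `⌊n τ⌋` (mod `n`);
* `Curve.shift_apply_eq_fract`, `Curve.reverse_shift_apply_eq_fract` — a shifted loop, resp. a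
  shifted reversed loop, read at time `v` is the loop at time `fract (v + b)`, resp.
  `fract (-(v + b))`.

## References

* F. Camia, C. M. Newman, Comm. Math. Phys. 268 (2006), §2, §4. [CamiaNewman2006]
* H. Duminil-Copin et al., arXiv:2012.11672v2 (2026), §1.2 eq. (1). [arXiv201211672v2]
-/

noncomputable section

open Set Metric
open scoped unitInterval

/-! ### Shifted and reversed loops read at fractional times -/

namespace Literature.Probability.RandomPlanarGeometry.Curve

variable {E : Type*} [TopologicalSpace E]

/-- A shifted loop at time `v` is the loop at time `fract (v + b)`. [folklore] -/
theorem shift_apply_eq_fract {γ : Curve E} (hγ : γ.IsLoop) (b : ℝ) (v : I) :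
    γ.shift b v = γ ⟨Int.fract ((v : ℝ) + b), Int.fract_nonneg _, (Int.fract_lt_one _).le⟩ := by
  rw [shift_apply hγ, loopMap_coe_eq]

/-- A shifted reversed loop at time `v` is the loop at time `fract (-(v + b))`. [folklore] -/
theorem reverse_shift_apply_eq_fract {γ : Curve E} (hγ : γ.IsLoop) (b : ℝ) (v : I) :
    (γ.reverse.shift b) v =
      γ ⟨Int.fract (-((v : ℝ) + b)), Int.fract_nonneg _, (Int.fract_lt_one _).le⟩ := by
  rw [shift_apply ((isLoop_reverse_iff γ).2 hγ), loopMap_coe_eq, reverse_apply]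
  apply apply_eq_of_fract_eq hγ
  simp only [unitInterval.coe_symm_eq, Int.fract_fract]
  set f : ℝ := Int.fract ((v : ℝ) + b) with hf
  by_cases h0 : f = 0
  · rw [h0, sub_zero, Int.fract_one, eq_comm, Int.fract_neg_eq_zero, ← hf, h0]
  · rw [Int.fract_neg h0, ← hf]
    have h1 : 0 < f := lt_of_le_of_ne (Int.fract_nonneg _) (Ne.symm h0)
    have h2 : f < 1 := Int.fract_lt_one _
    exact Int.fract_eq_self.2 ⟨by linarith, by linarith⟩

end Literature.Probability.RandomPlanarGeometry.Curve

namespace Literature.Probability.Percolation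

open RandomPlanarGeometry

/-- Index congruence for `getElem`. [folklore] -/
theorem getElem_congr_idx {α : Type*} {l : List α} {x y : ℕ} (hxy : x = y) (hx : x < l.length) :
    l[x] = l[y]'(hxy ▸ hx) := by
  subst hxy
  rfl

variable {E : Type*} [NormedAddCommGroup E] [NormedSpace ℝ E]

/-! ### Times on an edge -/

/-- **The closed polygon on its `j`-th edge, parameter form**: if `j < n` and
`j ≤ n t ≤ j + 1` then `closedCurve pts t` lies on the segment from `pts[j]` to
`pts[(j+1) % n]`. [cite: CamiaNewman2006, §2] -/
theorem closedCurve_apply_mem_segment {pts : List E} (hn : pts ≠ []) {j : ℕ} (hj : j < pts.length)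
    {t : I} (h1 : (j : ℝ) ≤ pts.length * t) (h2 : (pts.length : ℝ) * t ≤ j + 1) :
    closedCurve pts t ∈ segment ℝ (pts[j % pts.length]'(Nat.mod_lt _ (List.length_pos_iff.2 hn)))
      (pts[(j + 1) % pts.length]'(Nat.mod_lt _ (List.length_pos_iff.2 hn))) := by
  rw [closedCurve_apply hn, affineInterp_closed_eq_lineMap hn hj ⟨h1, h2⟩, segment_eq_image_lineMap]
  exact ⟨_, ⟨by linarith, by linarith⟩, rfl⟩

/-- **On `[j₁/n, (j₂+1)/n]` the closed polygon is on one of the edges `j₁, …, j₂`**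
(`j₁ ≤ j₂ < n`). [cite: CamiaNewman2006, §2] -/
theorem closedCurve_apply_mem_iUnion_segment {pts : List E} (hn : pts ≠ []) {j₁ j₂ : ℕ}
    (h12 : j₁ ≤ j₂) (hj₂ : j₂ < pts.length) {t : I} (h1 : (j₁ : ℝ) ≤ pts.length * t)
    (h2 : (pts.length : ℝ) * t ≤ j₂ + 1) :
    ∃ j, j₁ ≤ j ∧ j ≤ j₂ ∧ closedCurve pts t ∈
      segment ℝ (pts[j % pts.length]'(Nat.mod_lt _ (List.length_pos_iff.2 hn)))
        (pts[(j + 1) % pts.length]'(Nat.mod_lt _ (List.length_pos_iff.2 hn))) := by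
  set s : ℝ := pts.length * t with hs
  have hs0 : 0 ≤ s := by have := t.2.1; positivity
  set j : ℕ := min ⌊s⌋₊ j₂ with hj
  have hjle : j ≤ j₂ := min_le_right _ _
  have hj₁ : j₁ ≤ j := le_min (Nat.le_floor h1) h12
  refine ⟨j, hj₁, hjle, closedCurve_apply_mem_segment hn (hjle.trans_lt hj₂) ?_ ?_⟩
  · have : (j : ℝ) ≤ ⌊s⌋₊ := by exact_mod_cast min_le_left _ _
    exact this.trans (Nat.floor_le hs0)
  · rcases le_total ⌊s⌋₊ j₂ with h | h
    · rw [hj, min_eq_left h]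
      exact (Nat.lt_floor_add_one s).le
    · rw [hj, min_eq_right h]
      exact h2

/-- **Every point of the `j`-th edge is visited during `[j/n, (j+1)/n]`** (`j < n`).
[cite: CamiaNewman2006, §2] -/
theorem exists_closedCurve_apply_eq {pts : List E} (hn : pts ≠ []) {j : ℕ} (hj : j < pts.length)
    {z : E} (hz : z ∈ segment ℝ (pts[j % pts.length]'(Nat.mod_lt _ (List.length_pos_iff.2 hn)))
      (pts[(j + 1) % pts.length]'(Nat.mod_lt _ (List.length_pos_iff.2 hn)))) :
    ∃ t : I, (j : ℝ) ≤ pts.length * t ∧ (pts.length : ℝ) * t ≤ j + 1 ∧ closedCurve pts t = z := by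
  have hn' : (0 : ℝ) < pts.length := by exact_mod_cast List.length_pos_iff.2 hn
  rw [segment_eq_image_lineMap] at hz
  obtain ⟨θ, ⟨hθ0, hθ1⟩, rfl⟩ := hz
  have hj1 : (j : ℝ) + 1 ≤ pts.length := by exact_mod_cast hj
  have ht : ((j : ℝ) + θ) / pts.length ∈ I :=
    ⟨by positivity, by rw [div_le_one hn']; linarith⟩
  refine ⟨⟨_, ht⟩, ?_, ?_, ?_⟩
  · change (j : ℝ) ≤ pts.length * ((j + θ) / pts.length)
    rw [mul_div_cancel₀ _ hn'.ne']; linarith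
  · change (pts.length : ℝ) * ((j + θ) / pts.length) ≤ j + 1
    rw [mul_div_cancel₀ _ hn'.ne']; linarith
  · rw [closedCurve_apply hn]
    change affineInterp (pts ++ pts.take 1) (pts.length * ((j + θ) / pts.length)) = _
    rw [mul_div_cancel₀ _ hn'.ne', affineInterp_closed_eq_lineMap hn hj ⟨by linarith, by linarith⟩,
      add_sub_cancel_left]

/-! ### Unwrapped times -/

/-- **The closed polygon at an unwrapped time**: for `τ ≥ 0` the point `closedCurve pts (fract τ)`
lies on the edge of unwrapped index `J = ⌊n τ⌋`, i.e. on the segment from `pts[J % n]` to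
`pts[(J+1) % n]`. [cite: arXiv201211672v2, §1.2 eq. (1)] -/
theorem closedCurve_fract_mem_segment {pts : List E} (hn : pts ≠ []) {τ : ℝ} (hτ : 0 ≤ τ) :
    closedCurve pts ⟨Int.fract τ, Int.fract_nonneg _, (Int.fract_lt_one _).le⟩ ∈
      segment ℝ (pts[⌊(pts.length : ℝ) * τ⌋₊ % pts.length]'(Nat.mod_lt _ (List.length_pos_iff.2 hn)))
        (pts[(⌊(pts.length : ℝ) * τ⌋₊ + 1) % pts.length]'(Nat.mod_lt _ (List.length_pos_iff.2 hn))) := by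
  set n : ℕ := pts.length with hn_def
  have hn0 : 0 < n := List.length_pos_iff.2 hn
  set f : ℝ := Int.fract τ with hf
  have hf0 : 0 ≤ f := Int.fract_nonneg _
  have hf1 : f < 1 := Int.fract_lt_one _
  set j : ℕ := ⌊(n : ℝ) * f⌋₊ with hj
  have hjn : j < n := by
    rw [hj, Nat.floor_lt (by positivity)]
    calc (n : ℝ) * f < n * 1 := by gcongr
      _ = n := mul_one _
  -- `⌊n τ⌋ = n ⌊τ⌋ + j`
  have hτeq : τ = (⌊τ⌋₊ : ℝ) + f := by
    have h1 : ((⌊τ⌋₊ : ℕ) : ℝ) = ((⌊τ⌋ : ℤ) : ℝ) := by exact_mod_cast Int.natCast_floor_eq_floor hτ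
    rw [h1, hf, Int.floor_add_fract]
  have hJ : ⌊(n : ℝ) * τ⌋₊ = n * ⌊τ⌋₊ + j := by
    have : (n : ℝ) * τ = (n : ℝ) * f + ((n * ⌊τ⌋₊ : ℕ) : ℝ) := by
      nth_rewrite 1 [hτeq]; push_cast; ring
    rw [this, Nat.floor_add_natCast (by positivity), hj]; ring
  have hmod1 : ⌊(n : ℝ) * τ⌋₊ % n = j % n := by rw [hJ, Nat.mul_add_mod]
  have hmod2 : (⌊(n : ℝ) * τ⌋₊ + 1) % n = (j + 1) % n := by rw [hJ, add_assoc, Nat.mul_add_mod]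
  have key := closedCurve_apply_mem_segment hn hjn
    (t := ⟨f, hf0, hf1.le⟩) (Nat.floor_le (by positivity)) (Nat.lt_floor_add_one _).le
  have e1 : pts[⌊(n : ℝ) * τ⌋₊ % n]'(Nat.mod_lt _ hn0) = pts[j % n]'(Nat.mod_lt _ hn0) :=
    getElem_congr_idx hmod1 _
  have e2 : pts[(⌊(n : ℝ) * τ⌋₊ + 1) % n]'(Nat.mod_lt _ hn0) = pts[(j + 1) % n]'(Nat.mod_lt _ hn0) :=
    getElem_congr_idx hmod2 _
  rw [e1, e2]
  exact key

end Literature.Probability.Percolation
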